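import Summits.CriticalPhenomena.SAWScalingLimit.Theorems.SAWDevelopingMapInteriorFlatteningLiouvilleEquivalence

/-!
# `InteriorFlattening` split into its two leaf sub-cruxes (crux-strategist decomposition, D-0019 glued split)

Crux `stmt-CriticalPhenomena-8297` = `Summit.CriticalPhenomena.SAWScalingLimit.Theses.SAWDevelopingMap.InteriorFlattening`
((M) of route `SAWDevelopingMap`: bulk flattening of the Duminil-Copin–Smirnov parafermionic observable, pointwise
and uniform in the simply connected domain and its boundary root). Strategist seat
`planner-cstrat-stmt-CriticalPhenomena-8297-p1-0` (wall-breaker on the exhausted line chain, 2026-08-17).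

The landed Liouville equivalence (`interiorFlattening_iff_bulkNoFold_and_subsingleton`, …LiouvilleEquivalence,
p115301) says, UNCONDITIONALLY,

  `InteriorFlattening ⟺ BulkNoFold ∧ LocalLimits.Subsingleton`,

both conjuncts being NECESSARY (`BulkNoFold.bulkNoFold_of_interiorFlattening`, ε = 1/2;
`localLimits_subsingleton_of_interiorFlattening`, …LiouvilleNecessity) and jointly sufficient
(`interiorFlattening_of_bulkNoFold_of_subsingleton`). The two conjuncts are statements of different TYPE:

* `BulkNoFold` — a finite-depth, quantitative inequality: SOME `k < 1` bounds the Beltrami quotient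
  `‖F₀ + ωF₁ + ω²F₂‖ / ‖F₀ + F₁ + F₂‖` at every `R₀`-deep vertex, uniformly over simply connected `(Λ, a)` and frames
  (falsifiable by one exact configuration at one depth; implied by the route's rank-2 crux `NoFoldBound`);
* `LocalLimitsUnique` — a qualitative, `ε`-free, `R`-free rigidity statement: all lattice-scale local limits of
  `M(O)`-normalised observables at infinitely deep vertices coincide (then every local limit is the constant `1/3`,
  `interiorFlattening_iff_bulkNoFold_and_subset_constThird`): Duminil-Copin–Smirnov's "the same limit regardless
  of the orientation of the edge" (arXiv:1007.0575 p. 7) in Liouville form.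

A route file cannot import this sub-problem's Theorems-side Defs module, so the two children are filed in the
route in ROUTE VOCABULARY (only `hexParafermionicObservable`, `hexCriticalFugacity`, `hexDomainSimplyConnected`,
`hexDomainBoundary`, `hexCenter`, `hexGraph`, `Site`, `HexVertex`, Mathlib). This file records, sorry-free:

* `bulkNoFold_rv_iff`, `localLimitsUnique_rv_iff` — the route-vocabulary texts are DEFINITIONALLY (`Iff.rfl`) the
  Defs-side statements `∃ k R₀, 0 ≤ k ∧ k < 1 ∧ RatioAtDepth R₀ k` and `LocalLimits.Subsingleton`;
* `InteriorFlattening_of_subs` — THE GLUE `BulkNoFold → LocalLimitsUnique → InteriorFlattening` over the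
  route-vocabulary texts (the `--glue-by` declaration of the split);
* `subs_of_InteriorFlattening` — the converse: both children are necessary, so the split loses nothing.

Sources: H. Duminil-Copin, S. Smirnov, Ann. of Math. 175 (2012) 1653–1665 (arXiv:1007.0575), p. 7 (L64–66 of the
held text: "we expect that in the limit the curl vanishes, which is equivalent to F_δ(z) having the same limit
regardless of the orientation of the edge z"); `…LiouvilleEquivalence` (p115301), `…LiouvilleNecessity` (p103986),
`…LiouvilleBulkNoFold` (p104169), `…LiouvillePromotion` (p133334); the crux work files
`Cruxes/InteriorFlattening/{Lines/*-dead.md, STRATEGY-CENSUS.md}`.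
-/

noncomputable section

open scoped BigOperators Topology
open Filter Literature.Probability.LatticeModels Literature.Probability.RandomPlanarGeometry.SAW

namespace Summit.CriticalPhenomena.SAWScalingLimit.Theorems.InteriorFlattening.Split

open Summit.CriticalPhenomena.SAWScalingLimit.Theorems.InteriorFlattening.Liouville

/-- **Child 1 in route vocabulary is the Defs-side `BulkNoFold`** (definitional; same text as
`Promotion.bulkNoFold_iff_routeVocabulary`). -/
theorem bulkNoFold_rv_iff :
    (∃ k R₀ : ℝ, 0 ≤ k ∧ k < 1 ∧ ∀ (Λ : Finset Literature.Probability.LatticeModels.HexVertex),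
      Literature.Probability.RandomPlanarGeometry.SAW.hexDomainSimplyConnected Λ →
      ∀ a ∈ Literature.Probability.RandomPlanarGeometry.SAW.hexDomainBoundary Λ, ∀ v ∈ Λ,
        (∀ w : Literature.Probability.LatticeModels.HexVertex,
          dist (Literature.Probability.LatticeModels.hexCenter w) (Literature.Probability.LatticeModels.hexCenter v) ≤ R₀ →
            w ∈ Λ) →
        ∀ w₀ w₁ w₂ : Literature.Probability.LatticeModels.HexVertex,
          Literature.Probability.LatticeModels.hexGraph.Adj v w₀ → Literature.Probability.LatticeModels.hexGraph.Adj v w₁ →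
          Literature.Probability.LatticeModels.hexGraph.Adj v w₂ → w₀ ≠ w₁ → w₁ ≠ w₂ → w₀ ≠ w₂ →
            let F : Sym2 Literature.Probability.LatticeModels.HexVertex → ℂ :=
              Literature.Probability.RandomPlanarGeometry.SAW.hexParafermionicObservable Λ a
                Literature.Probability.RandomPlanarGeometry.SAW.hexCriticalFugacity (5 / 8)
            let ω : ℂ := Complex.exp (2 * Real.pi * Complex.I / 3)
            ‖F s(v, w₀) + ω * F s(v, w₁) + ω ^ 2 * F s(v, w₂)‖ ≤ k * ‖F s(v, w₀) + F s(v, w₁) + F s(v, w₂)‖) ↔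
      (∃ k R₀ : ℝ, 0 ≤ k ∧ k < 1 ∧ RatioAtDepth R₀ k) :=
  Iff.rfl

/-- **Child 2 in route vocabulary is the Defs-side `LocalLimits.Subsingleton`** (definitional): with
`O = ((0 : Site 2), 0)` and its neighbours `A = (0, 1)`, `B = (-e₀, 1)`, `C = (-e₁, 1)`, the class of pointwise
limits on the honeycomb's edges of `F_{Λₙ,aₙ}(·) / (F{O,A} + F{O,B} + F{O,C})` over admissible sequences
(simply connected, boundary root, `O` `n`-deep, non-zero monopole) has at most one element. -/
theorem localLimitsUnique_rv_iff :
    (let O : Literature.Probability.LatticeModels.HexVertex :=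
        ((0 : Literature.Probability.LatticeModels.Site 2), (0 : Fin 2))
      let A : Literature.Probability.LatticeModels.HexVertex :=
        ((0 : Literature.Probability.LatticeModels.Site 2), (1 : Fin 2))
      let B : Literature.Probability.LatticeModels.HexVertex :=
        ((-(Pi.single 0 1) : Literature.Probability.LatticeModels.Site 2), (1 : Fin 2))
      let C : Literature.Probability.LatticeModels.HexVertex :=
        ((-(Pi.single 1 1) : Literature.Probability.LatticeModels.Site 2), (1 : Fin 2))
      let F : Finset Literature.Probability.LatticeModels.HexVertex →
          Sym2 Literature.Probability.LatticeModels.HexVertex →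
            Sym2 Literature.Probability.LatticeModels.HexVertex → ℂ :=
        fun Λ a z => Literature.Probability.RandomPlanarGeometry.SAW.hexParafermionicObservable Λ a
          Literature.Probability.RandomPlanarGeometry.SAW.hexCriticalFugacity (5 / 8) z
      let M : Finset Literature.Probability.LatticeModels.HexVertex →
          Sym2 Literature.Probability.LatticeModels.HexVertex → ℂ :=
        fun Λ a => F Λ a s(O, A) + F Λ a s(O, B) + F Λ a s(O, C)
      let LocalLimits : Set (Sym2 Literature.Probability.LatticeModels.HexVertex → ℂ) :=
        {G | (∀ z : Sym2 Literature.Probability.LatticeModels.HexVertex,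
              z ∉ Literature.Probability.LatticeModels.hexGraph.edgeSet → G z = 0) ∧
            ∃ (Λ : ℕ → Finset Literature.Probability.LatticeModels.HexVertex)
              (a : ℕ → Sym2 Literature.Probability.LatticeModels.HexVertex),
              (∀ n : ℕ, Literature.Probability.RandomPlanarGeometry.SAW.hexDomainSimplyConnected (Λ n) ∧
                a n ∈ Literature.Probability.RandomPlanarGeometry.SAW.hexDomainBoundary (Λ n) ∧
                ∀ w : Literature.Probability.LatticeModels.HexVertex,
                  dist (Literature.Probability.LatticeModels.hexCenter w)
                    (Literature.Probability.LatticeModels.hexCenter O) ≤ (n : ℝ) → w ∈ Λ n) ∧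
              (∀ n : ℕ, M (Λ n) (a n) ≠ 0) ∧
              ∀ z ∈ Literature.Probability.LatticeModels.hexGraph.edgeSet,
                Filter.Tendsto (fun n : ℕ => F (Λ n) (a n) z / M (Λ n) (a n)) Filter.atTop (nhds (G z))}
      LocalLimits.Subsingleton) ↔
      LocalLimits.Subsingleton :=
  Iff.rfl

/-- **THE GLUE of the split** (`--glue-by` declaration): `BulkNoFold → LocalLimitsUnique → InteriorFlattening`,
both hypotheses in the route-vocabulary texts of the two children. Proof: read both back into the Defs
vocabulary (definitional) and apply the landed `interiorFlattening_of_bulkNoFold_of_subsingleton`. -/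
theorem InteriorFlattening_of_subs :
    (∃ k R₀ : ℝ, 0 ≤ k ∧ k < 1 ∧ ∀ (Λ : Finset Literature.Probability.LatticeModels.HexVertex),
      Literature.Probability.RandomPlanarGeometry.SAW.hexDomainSimplyConnected Λ →
      ∀ a ∈ Literature.Probability.RandomPlanarGeometry.SAW.hexDomainBoundary Λ, ∀ v ∈ Λ,
        (∀ w : Literature.Probability.LatticeModels.HexVertex,
          dist (Literature.Probability.LatticeModels.hexCenter w) (Literature.Probability.LatticeModels.hexCenter v) ≤ R₀ →
            w ∈ Λ) →
        ∀ w₀ w₁ w₂ : Literature.Probability.LatticeModels.HexVertex,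
          Literature.Probability.LatticeModels.hexGraph.Adj v w₀ → Literature.Probability.LatticeModels.hexGraph.Adj v w₁ →
          Literature.Probability.LatticeModels.hexGraph.Adj v w₂ → w₀ ≠ w₁ → w₁ ≠ w₂ → w₀ ≠ w₂ →
            let F : Sym2 Literature.Probability.LatticeModels.HexVertex → ℂ :=
              Literature.Probability.RandomPlanarGeometry.SAW.hexParafermionicObservable Λ a
                Literature.Probability.RandomPlanarGeometry.SAW.hexCriticalFugacity (5 / 8)
            let ω : ℂ := Complex.exp (2 * Real.pi * Complex.I / 3)
            ‖F s(v, w₀) + ω * F s(v, w₁) + ω ^ 2 * F s(v, w₂)‖ ≤ k * ‖F s(v, w₀) + F s(v, w₁) + F s(v, w₂)‖) →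
    (let O : Literature.Probability.LatticeModels.HexVertex :=
        ((0 : Literature.Probability.LatticeModels.Site 2), (0 : Fin 2))
      let A : Literature.Probability.LatticeModels.HexVertex :=
        ((0 : Literature.Probability.LatticeModels.Site 2), (1 : Fin 2))
      let B : Literature.Probability.LatticeModels.HexVertex :=
        ((-(Pi.single 0 1) : Literature.Probability.LatticeModels.Site 2), (1 : Fin 2))
      let C : Literature.Probability.LatticeModels.HexVertex :=
        ((-(Pi.single 1 1) : Literature.Probability.LatticeModels.Site 2), (1 : Fin 2))
      let F : Finset Literature.Probability.LatticeModels.HexVertex →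
          Sym2 Literature.Probability.LatticeModels.HexVertex →
            Sym2 Literature.Probability.LatticeModels.HexVertex → ℂ :=
        fun Λ a z => Literature.Probability.RandomPlanarGeometry.SAW.hexParafermionicObservable Λ a
          Literature.Probability.RandomPlanarGeometry.SAW.hexCriticalFugacity (5 / 8) z
      let M : Finset Literature.Probability.LatticeModels.HexVertex →
          Sym2 Literature.Probability.LatticeModels.HexVertex → ℂ :=
        fun Λ a => F Λ a s(O, A) + F Λ a s(O, B) + F Λ a s(O, C)
      let LocalLimits : Set (Sym2 Literature.Probability.LatticeModels.HexVertex → ℂ) :=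
        {G | (∀ z : Sym2 Literature.Probability.LatticeModels.HexVertex,
              z ∉ Literature.Probability.LatticeModels.hexGraph.edgeSet → G z = 0) ∧
            ∃ (Λ : ℕ → Finset Literature.Probability.LatticeModels.HexVertex)
              (a : ℕ → Sym2 Literature.Probability.LatticeModels.HexVertex),
              (∀ n : ℕ, Literature.Probability.RandomPlanarGeometry.SAW.hexDomainSimplyConnected (Λ n) ∧
                a n ∈ Literature.Probability.RandomPlanarGeometry.SAW.hexDomainBoundary (Λ n) ∧
                ∀ w : Literature.Probability.LatticeModels.HexVertex,
                  dist (Literature.Probability.LatticeModels.hexCenter w)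
                    (Literature.Probability.LatticeModels.hexCenter O) ≤ (n : ℝ) → w ∈ Λ n) ∧
              (∀ n : ℕ, M (Λ n) (a n) ≠ 0) ∧
              ∀ z ∈ Literature.Probability.LatticeModels.hexGraph.edgeSet,
                Filter.Tendsto (fun n : ℕ => F (Λ n) (a n) z / M (Λ n) (a n)) Filter.atTop (nhds (G z))}
      LocalLimits.Subsingleton) →
    Summit.CriticalPhenomena.SAWScalingLimit.Theses.SAWDevelopingMap.InteriorFlattening :=
  fun h₁ h₂ => interiorFlattening_of_bulkNoFold_of_subsingleton (bulkNoFold_rv_iff.1 h₁) (localLimitsUnique_rv_iff.1 h₂)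

/-- **The split loses nothing**: the crux implies both children (in their route-vocabulary texts). -/
theorem subs_of_InteriorFlattening
    (h : Summit.CriticalPhenomena.SAWScalingLimit.Theses.SAWDevelopingMap.InteriorFlattening) :
    (∃ k R₀ : ℝ, 0 ≤ k ∧ k < 1 ∧ ∀ (Λ : Finset Literature.Probability.LatticeModels.HexVertex),
      Literature.Probability.RandomPlanarGeometry.SAW.hexDomainSimplyConnected Λ →
      ∀ a ∈ Literature.Probability.RandomPlanarGeometry.SAW.hexDomainBoundary Λ, ∀ v ∈ Λ,
        (∀ w : Literature.Probability.LatticeModels.HexVertex,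
          dist (Literature.Probability.LatticeModels.hexCenter w) (Literature.Probability.LatticeModels.hexCenter v) ≤ R₀ →
            w ∈ Λ) →
        ∀ w₀ w₁ w₂ : Literature.Probability.LatticeModels.HexVertex,
          Literature.Probability.LatticeModels.hexGraph.Adj v w₀ → Literature.Probability.LatticeModels.hexGraph.Adj v w₁ →
          Literature.Probability.LatticeModels.hexGraph.Adj v w₂ → w₀ ≠ w₁ → w₁ ≠ w₂ → w₀ ≠ w₂ →
            let F : Sym2 Literature.Probability.LatticeModels.HexVertex → ℂ :=
              Literature.Probability.RandomPlanarGeometry.SAW.hexParafermionicObservable Λ a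
                Literature.Probability.RandomPlanarGeometry.SAW.hexCriticalFugacity (5 / 8)
            let ω : ℂ := Complex.exp (2 * Real.pi * Complex.I / 3)
            ‖F s(v, w₀) + ω * F s(v, w₁) + ω ^ 2 * F s(v, w₂)‖ ≤ k * ‖F s(v, w₀) + F s(v, w₁) + F s(v, w₂)‖) ∧
    (let O : Literature.Probability.LatticeModels.HexVertex :=
        ((0 : Literature.Probability.LatticeModels.Site 2), (0 : Fin 2))
      let A : Literature.Probability.LatticeModels.HexVertex :=
        ((0 : Literature.Probability.LatticeModels.Site 2), (1 : Fin 2))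
      let B : Literature.Probability.LatticeModels.HexVertex :=
        ((-(Pi.single 0 1) : Literature.Probability.LatticeModels.Site 2), (1 : Fin 2))
      let C : Literature.Probability.LatticeModels.HexVertex :=
        ((-(Pi.single 1 1) : Literature.Probability.LatticeModels.Site 2), (1 : Fin 2))
      let F : Finset Literature.Probability.LatticeModels.HexVertex →
          Sym2 Literature.Probability.LatticeModels.HexVertex →
            Sym2 Literature.Probability.LatticeModels.HexVertex → ℂ :=
        fun Λ a z => Literature.Probability.RandomPlanarGeometry.SAW.hexParafermionicObservable Λ a
          Literature.Probability.RandomPlanarGeometry.SAW.hexCriticalFugacity (5 / 8) z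
      let M : Finset Literature.Probability.LatticeModels.HexVertex →
          Sym2 Literature.Probability.LatticeModels.HexVertex → ℂ :=
        fun Λ a => F Λ a s(O, A) + F Λ a s(O, B) + F Λ a s(O, C)
      let LocalLimits : Set (Sym2 Literature.Probability.LatticeModels.HexVertex → ℂ) :=
        {G | (∀ z : Sym2 Literature.Probability.LatticeModels.HexVertex,
              z ∉ Literature.Probability.LatticeModels.hexGraph.edgeSet → G z = 0) ∧
            ∃ (Λ : ℕ → Finset Literature.Probability.LatticeModels.HexVertex)
              (a : ℕ → Sym2 Literature.Probability.LatticeModels.HexVertex),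
              (∀ n : ℕ, Literature.Probability.RandomPlanarGeometry.SAW.hexDomainSimplyConnected (Λ n) ∧
                a n ∈ Literature.Probability.RandomPlanarGeometry.SAW.hexDomainBoundary (Λ n) ∧
                ∀ w : Literature.Probability.LatticeModels.HexVertex,
                  dist (Literature.Probability.LatticeModels.hexCenter w)
                    (Literature.Probability.LatticeModels.hexCenter O) ≤ (n : ℝ) → w ∈ Λ n) ∧
              (∀ n : ℕ, M (Λ n) (a n) ≠ 0) ∧
              ∀ z ∈ Literature.Probability.LatticeModels.hexGraph.edgeSet,
                Filter.Tendsto (fun n : ℕ => F (Λ n) (a n) z / M (Λ n) (a n)) Filter.atTop (nhds (G z))}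
      LocalLimits.Subsingleton) :=
  ⟨bulkNoFold_rv_iff.2 (BulkNoFold.bulkNoFold_of_interiorFlattening h),
    localLimitsUnique_rv_iff.2 (localLimits_subsingleton_of_interiorFlattening h)⟩

end Summit.CriticalPhenomena.SAWScalingLimit.Theorems.InteriorFlattening.Split

end
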